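import Summits.BirchSwinnertonDyer.BirchSwinnertonDyer.Theorems.PrintX9GreenbergMuBridge
import Summits.BirchSwinnertonDyer.Rank1Residual.X10.CoreTheoremAOddPrimeHolds
import HarnessLib

/-!
# Class X9: Greenberg's `μ = 0` on the ALGEBRAIC side and on the ANALYTIC side are EQUIVALENT modulo
# print — the residual cruxes of the two X9 roads (K6 `SmallImageMuTransfer` / the print road of
# `PrintX9GreenbergMuBridge`) coincide

Cell `pub/bsd-print-x9` (D-0131 (2) print tier), seat `bsd-print-x9-p1`. THEOREMS ONLY; nothing booked.

On class X9 (non-CM, good ordinary `p ≥ 5`, `E[p]` irreducible, `ρ̄_{E,p}` not surjective) two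
class-wide `μ`-statements are in the kernel's bookkeeping as the open inputs of two roads to the K6
leaf `BSDpOnClassX9`:
* ANALYTIC: `AnalyticMuZeroOnClassX9` (= route items `SmallImageMuTransfer.AnalyticMuZeroX9` /
  `PrintX9.AnalyticMuZeroX9`, stmt 19630): some coefficient of `L_p(f, α)` is a `p`-adic unit;
* ALGEBRAIC: «`MuAlgZeroOnClassX9`» — `μ(X(E/ℚ_∞)) = 0` for every cyclotomic dual datum at every X9
  pair (the cell's binder shape `hμ`; Greenberg, LNM 1716 Conj. 1.11, restricted to X9).
The K6 cell PROVED analytic ⟹ algebraic modulo Kato's zeta-element package F1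
(`Kato2004.exists_divisibilityInputs_fineQuotient_zeta`): `X10.mu_eq_zero_of_fine` (p480380, the kernel
core behind `smallImageMuTransfer_MuTransfer_of_fine : F1 → KatoMuTransfer`, p482919). The print road
PROVED algebraic ⟹ analytic modulo Burungale–Castella–Skinner Thm. 1.1.2 (a) + display (5.3)
(`analyticMuZeroOnClassX9_of_muZeroOnClassX9`, p536327). This file states the EQUIVALENCE modulo the
union of those printed inputs — so a planner may file EITHER statement as the residual crux of the
X9 leaf, and a per-pair certificate of one is a certificate of the other (modulo print).

* `muAlgZeroOnClassX9_iff_analyticMuZeroOnClassX9_of_fine` — `(∀ X9 pairs, ∀ (κ,γ), ∀ D, D.mu = 0) ↔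
  AnalyticMuZeroOnClassX9` (the latter is, by definition, route items `SmallImageMuTransfer.AnalyticMuZeroX9`
  = `PrintX9.AnalyticMuZeroX9`), granted F1 (`hF1`), BCS (a) (`hBCS`), BCS (5.3) (`h53`), modularity
  (`hmod`, `hmodP`), the period unit (`h5`).
Honest status: CONDITIONAL on named facts only (flags: F1 print-not-held; BCS `BCS25-IMC-equiv@…`);
beyond-print theorem: no.

References: [Kato2004Asterisque] Thm. 12.5/12.6, §17.13; [BurungaleCastellaSkinner2025] Thm. 1.1.2 (a),
display (5.3); [GreenbergLNM1716] Conj. 1.11; [GreenbergVatsal2000] p. 2 (1)–(2), Prop. 3.7, Rem. 3.4.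
-/

set_option linter.dupNamespace false

set_option autoImplicit false

noncomputable section

open scoped Classical

open CongruenceSubgroup WeierstrassCurve Field
open Literature.NumberTheory.EllipticCurves Literature.NumberTheory.EllipticCurves.ModularForms
open Literature.NumberTheory.EllipticCurves.Kato2004 (exists_divisibilityInputs_fineQuotient_zeta)
open Literature.NumberTheory.EllipticCurves.BurungaleCastellaSkinner2025
  (display53_prod_charIdeal_le_prod_padicLFunction)

namespace Summit.BirchSwinnertonDyer.BirchSwinnertonDyer.Rank1Residual

/-- **On class X9, `μ_alg = 0` ↔ `μ_an = 0`, modulo print.** (⟸) Kato's package F1 gives the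
`μ`-transfer at a non-surjective irreducible odd good ordinary prime (`X10.mu_eq_zero_of_fine`, the
UNCONDITIONAL kernel core of cells `bsd-smallim` / b2b x10), and with the analytic `μ = 0` at the pair the
algebraic one; (⟹) the
print road (`analyticMuZeroOnClassX9_of_muZeroOnClassX9`: BCS (a) ×4 + display (5.3) + GV Prop. 3.7).
[cite: Kato2004Asterisque, Thm. 12.5, 12.6 and §17.13 (p. 280)]
[cite: BurungaleCastellaSkinner2025, Thm. 1.1.2 (a) and display (5.3) (pp. 2, 10 of arXiv:2405.00270v2)]
[cite: GreenbergLNM1716, §1 Conj. 1.11] -/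
theorem muAlgZeroOnClassX9_iff_analyticMuZeroOnClassX9_of_fine
    (hF1 : exists_divisibilityInputs_fineQuotient_zeta)
    (hBCS : burungale_castella_skinner_charIdeal_eq_padicLFunction)
    (h53 : display53_prod_charIdeal_le_prod_padicLFunction)
    (hmod : exists_isNewformOf) (hmodP : nonempty_modularParametrizationData)
    (h5 : realPeriodRat_eq_unit_mul_plusPeriod) :
    (∀ (V : WeierstrassCurve ℚ) [V.IsElliptic] [V.IsGloballyMinimal] (p : ℕ) [Fact p.Prime],
      ClassX9 V p → ∀ (κ : ZpExtension ℚ p) (γ : Field.absoluteGaloisGroup ℚ),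
        κ.IsCyclotomic → κ.IsTopGenerator γ → IsCyclotomicVariable p γ →
        ∀ D : V.SelmerDualData κ γ, D.mu = 0) ↔ AnalyticMuZeroOnClassX9 := by
  constructor
  · intro hμ
    exact analyticMuZeroOnClassX9_of_muZeroOnClassX9 hμ hBCS h53 hmod h5
  · intro hA V _ _ p _ hX κ γ hκ hγ hγ' D
    obtain ⟨-, hp, hgood, hord, hirr, hns⟩ := id hX
    haveI : NeZero (V.conductorNorm ℤ) := ⟨(V.conductorNorm_pos_holds).ne'⟩
    obtain ⟨Dm⟩ := hmodP V
    exact Summit.BirchSwinnertonDyer.Rank1Residual.X10.mu_eq_zero_of_fine hF1 V p Dm.f (by omega) hgood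
      hord hirr hns Dm.isNewformOf (hA V p Dm.f hX Dm.isNewformOf) κ γ hκ hγ hγ' D

end Summit.BirchSwinnertonDyer.BirchSwinnertonDyer.Rank1Residual

end
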